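import Literature.NumberTheory.EllipticCurves.SubgroupSelmerCocycleCriteriaProofs
import Mathlib.Topology.Algebra.ClopenNhdofOne
import HarnessLib

/-!
# `H¹(H, M) = lim→_{U ⊇ H open} H¹(U, M)` for a closed subgroup `H` of a profinite group, in the cocycle
# currency of `subgroupH1` (Serre, *Galois Cohomology* I §2.2 Prop. 8, degree `1`)

Topic `NumberTheory/EllipticCurves` (next to `SubgroupSelmer`; namespace
`Literature.NumberTheory.EllipticCurves.SubgroupH1Colimit`).  THEOREMS ONLY (no definition, no named
fact, no instance, no `sorry`).  `G` is a profinite group (compact, totally disconnected topological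
group), `M` a discrete `G`-module with open stabilizers, `H ≤ G` CLOSED, and `U : ℕ → Subgroup G` a family
of subgroups above `H` which is COFINAL among the open neighbourhoods of `H` (`hcof`; e.g. a decreasing
sequence of open subgroups with `⋂ₙ Uₙ = H`, §1).  Written for cell `bsd-print-cf2` (seat cf2c-w8 g8,
plug (π3) of ROW 1: exhaustion of `H¹(K̃_∞, ·)` by the layers `K̃_n`, `H = pairKer κ₁ κ₂ = ⋂ₙ Vₙ`).

* §1 `exists_coe_subset_of_antitone` — COFINALITY from compactness: `Uₙ` open, antitone, `⋂ₙ Uₙ ≤ H` ⟹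
  every open `V ⊇ H` contains some `Uₙ`.
* §2 `exists_mem_range_resOfLe` — SURJECTIVITY: every class of `H¹(H, M)` is `res_{H}^{Uₙ}` of a class of
  `H¹(Uₙ, M)` for some `n` (a continuous cocycle on `H` takes finitely many values, vanishes on `H ∩ W`
  and has `W`-fixed values for an open normal `W`; it extends to `H·W ⊇ Uₙ` by `c̃(hw) = c(h)`).
* §3 `exists_resOfLe_eq_zero` — INJECTIVITY: a class of `H¹(Uₘ, M)` dying on `H` dies on some `Uₙ ≤ Uₘ`
  (the corrected cocycle vanishes on an open neighbourhood of `H`).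
* §4 `exists_resOfLe_eq_resOfLe` — two layer classes with the same restriction to `H` agree on a deeper layer.

HONEST FRAMING: topological group cohomology only; no arithmetic statement is proved here.

## References
* J.-P. Serre, *Galois Cohomology* (1997), I §2.2 Proposition 8. [SerreGaloisCohomology1997]
* J. Neukirch, A. Schmidt, K. Wingberg, *Cohomology of Number Fields* (2008), I §5 (1.5.1). [NeukirchSchmidtWingberg2008]
-/

noncomputable section

open Topology
open scoped Pointwise
open Literature.NumberTheory.GaloisRepresentations

universe u

namespace Literature.NumberTheory.EllipticCurves.SubgroupH1Colimit

open Literature.NumberTheory.EllipticCurves.CocycleCriteria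

variable {G : Type u} [Group G] [TopologicalSpace G] [IsTopologicalGroup G]
  {M : Type u} [AddCommGroup M] [DistribMulAction G M] [TopologicalSpace M] [DiscreteTopology M]

/-! ## §1 Cofinality from compactness -/

/-- **In a compact group a decreasing sequence of open subgroups is cofinal among the open neighbourhoods
of any closed set containing its intersection**: `Uₙ` open, antitone, `⋂ₙ Uₙ ⊆ H ⊆ V` open ⟹ `Uₙ ⊆ V` for
some `n`. [cite: SerreGaloisCohomology1997, I §1.1] [cite: NeukirchSchmidtWingberg2008, I §5 (1.5.1)] -/
theorem exists_coe_subset_of_antitone [CompactSpace G] (U : ℕ → Subgroup G)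
    (hU : ∀ n, IsOpen (U n : Set G)) (hanti : Antitone U) {H : Set G}
    (hH : ∀ g : G, (∀ n, g ∈ U n) → g ∈ H) {V : Set G} (hV : IsOpen V) (hHV : H ⊆ V) :
    ∃ n, (U n : Set G) ⊆ V := by
  have hst : Vᶜ ∩ ⋂ n, (U n : Set G) = ∅ := by
    refine Set.eq_empty_iff_forall_notMem.mpr fun g hg => hg.1 (hHV (hH g fun n => ?_))
    exact Set.mem_iInter.mp hg.2 n
  obtain ⟨n, hn⟩ := hV.isClosed_compl.isCompact.elim_directed_family_closed (fun n => (U n : Set G))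
    (fun n => (U n).isClosed_of_isOpen (hU n)) hst
    (fun n m => ⟨max n m, SetLike.coe_subset_coe.mpr (hanti (le_max_left n m)),
      SetLike.coe_subset_coe.mpr (hanti (le_max_right n m))⟩)
  refine ⟨n, fun g hg => ?_⟩
  by_contra hgV
  exact (Set.eq_empty_iff_forall_notMem.mp hn) g ⟨hgV, hg⟩

omit [IsTopologicalGroup G] [DiscreteTopology M] in
/-- With open stabilizers, `g ↦ g • a` is continuous into the discrete module (constant on the cosets
`g₀ · Stab(a)`). [cite: SerreGaloisCohomology1997, I §2.1] -/
theorem continuous_smul_const_of_isOpen_stabilizer [ContinuousMul G]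
    (hstab : ∀ m : M, IsOpen (MulAction.stabilizer G m : Set G)) (a : M) : Continuous fun g : G => g • a := by
  refine IsLocallyConstant.continuous ((IsLocallyConstant.iff_exists_open _).mpr fun g₀ => ?_)
  refine ⟨(fun g : G => g₀⁻¹ * g) ⁻¹' (MulAction.stabilizer G a : Set G),
    (hstab a).preimage (continuous_const_mul _), by simp, fun g hg => ?_⟩
  have h : g = g₀ * (g₀⁻¹ * g) := by group
  rw [h, mul_smul, MulAction.mem_stabilizer_iff.mp hg]

omit [IsTopologicalGroup G] in
/-- Independence of the representative: if `c` vanishes on `H ∩ W` then `c h' = c h` whenever `h⁻¹ h' ∈ W`.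
[cite: SerreGaloisCohomology1997, I §2.2 Prop. 8] -/
theorem apply_eq_of_inv_mul_mem {H : Subgroup G} (c : contOneCocycles (discreteTopRep H M)) {W : Set G}
    (hW0 : ∀ h : H, (h : G) ∈ W → c.1 h = 0) (h h' : H) (hhh' : (h : G)⁻¹ * h' ∈ W) : c.1 h' = c.1 h := by
  have hk : c.1 (h⁻¹ * h') = 0 := hW0 (h⁻¹ * h') (by simpa using hhh')
  have h2 := c.2 h (h⁻¹ * h')
  rw [mul_inv_cancel_left, hk, map_zero, add_zero] at h2
  exact h2

/-! ## §2 Surjectivity: every class of `H¹(H, M)` comes from an open neighbourhood subgroup -/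

section Profinite

variable [CompactSpace G] [TotallyDisconnectedSpace G]

/-- The data of the extension: for a continuous cocycle `c` on a closed `H` there is an open normal
subgroup `W` such that `c` vanishes on `H ∩ W` and `W` fixes every value of `c`.
[cite: SerreGaloisCohomology1997, I §2.2 Prop. 8] -/
theorem exists_openNormalSubgroup_adapted (hstab : ∀ m : M, IsOpen (MulAction.stabilizer G m : Set G))
    {H : Subgroup G} (hHc : IsClosed (H : Set G)) (c : contOneCocycles (discreteTopRep H M)) :
    ∃ W : OpenNormalSubgroup G, (∀ h : H, (h : G) ∈ (W : Set G) → c.1 h = 0) ∧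
      ∀ w ∈ (W : Set G), ∀ h : H, w • c.1 h = c.1 h := by
  haveI : CompactSpace H := isCompact_iff_compactSpace.mp hHc.isCompact
  -- finitely many values
  have hfin : (Set.range c.1).Finite := (isCompact_range c.1.continuous).finite_of_discrete
  -- the open set where `c` vanishes, as the trace of an open set of `G`
  obtain ⟨O, hO, hOc⟩ := isOpen_induced_iff.mp ((isOpen_discrete ({0} : Set M)).preimage c.1.continuous)
  have h1O : (1 : G) ∈ O := by
    have h : (1 : H) ∈ Subtype.val ⁻¹' O := by
      rw [hOc]
      show c.1 1 ∈ ({0} : Set M)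
      rw [contOneCocycles.apply_one]
      rfl
    exact h
  -- the open set fixing all the values
  set O₁ : Set G := ⋂ m ∈ hfin.toFinset, (MulAction.stabilizer G m : Set G) with hO₁
  have hO₁o : IsOpen O₁ := isOpen_biInter_finset fun m _ => hstab m
  have h1O₁ : (1 : G) ∈ O₁ := Set.mem_iInter₂.mpr fun m _ => (MulAction.stabilizer G m).one_mem
  obtain ⟨W, hW⟩ := ProfiniteGrp.exist_openNormalSubgroup_sub_open_nhds_of_one (hO.inter hO₁o) ⟨h1O, h1O₁⟩
  refine ⟨W, fun h hh => ?_, fun w hw h => ?_⟩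
  · have h' : h ∈ Subtype.val ⁻¹' O := (hW hh).1
    rw [hOc] at h'
    exact h'
  · have hw' : w ∈ (MulAction.stabilizer G (c.1 h) : Set G) :=
      Set.mem_iInter₂.mp (hW hw).2 (c.1 h) (hfin.mem_toFinset.mpr ⟨h, rfl⟩)
    exact hw'

/-- **SURJECTIVITY half of Serre I §2.2 Prop. 8 in degree `1`**: for `H ≤ G` closed, `M` discrete with open
stabilizers and a family `(Uₙ)` of subgroups above `H` cofinal among the open neighbourhoods of `H`, every
class of `H¹(H, M)` is the restriction of a class of `H¹(Uₙ, M)` for some `n`.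
[cite: SerreGaloisCohomology1997, I §2.2 Prop. 8] [cite: NeukirchSchmidtWingberg2008, I §5 (1.5.1)] -/
theorem exists_mem_range_resOfLe (hstab : ∀ m : M, IsOpen (MulAction.stabilizer G m : Set G))
    {H : Subgroup G} (hHc : IsClosed (H : Set G)) (U : ℕ → Subgroup G) (hle : ∀ n, H ≤ U n)
    (hcof : ∀ V : Set G, IsOpen V → (H : Set G) ⊆ V → ∃ n, (U n : Set G) ⊆ V)
    (x : subgroupH1 H M) : ∃ n, x ∈ (resOfLe M (hle n)).range := by
  obtain ⟨c, rfl⟩ := oneCocycleClass_surjective _ x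
  obtain ⟨W, hW0, hWfix⟩ := exists_openNormalSubgroup_adapted hstab hHc c
  -- the open neighbourhood `H·W` of `H`
  set V : Set G := {g : G | ∃ h : H, (h : G)⁻¹ * g ∈ (W : Set G)} with hV
  have hVo : IsOpen V := by
    have : V = ⋃ h : H, (fun g : G => (h : G)⁻¹ * g) ⁻¹' (W : Set G) := by
      ext g
      simp only [hV, Set.mem_setOf_eq, Set.mem_iUnion, Set.mem_preimage]
    rw [this]
    exact isOpen_iUnion fun h => W.isOpen'.preimage (continuous_const_mul _)
  have hHV : (H : Set G) ⊆ V := fun g hg => ⟨⟨g, hg⟩, by simp⟩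
  obtain ⟨n, hn⟩ := hcof V hVo hHV
  -- the extended cocycle `c̃(h w) = c(h)` on `Uₙ ⊆ H·W`
  have hrep : ∀ u : U n, ∃ h : H, (h : G)⁻¹ * (u : G) ∈ (W : Set G) := fun u => hn u.2
  choose rep hrep' using hrep
  have hval : ∀ (u : U n) (h : H), (h : G)⁻¹ * (u : G) ∈ (W : Set G) → c.1 (rep u) = c.1 h := by
    intro u h hh
    refine apply_eq_of_inv_mul_mem c hW0 h (rep u) ?_
    have h3 : (h : G)⁻¹ * (rep u : G) = ((h : G)⁻¹ * u) * ((rep u : G)⁻¹ * u)⁻¹ := by group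
    rw [h3]
    exact W.toSubgroup.mul_mem hh (W.toSubgroup.inv_mem (hrep' u))
  have hlc : IsLocallyConstant fun u : U n => c.1 (rep u) := by
    refine (IsLocallyConstant.iff_exists_open _).mpr fun u₀ => ?_
    refine ⟨(fun u : U n => (u₀ : G)⁻¹ * (u : G)) ⁻¹' (W : Set G),
      W.isOpen'.preimage ((continuous_const_mul _).comp continuous_subtype_val),
      by simp, fun u hu => ?_⟩
    -- `rep u₀` also represents `u`
    refine hval u (rep u₀) ?_
    have h3 : (rep u₀ : G)⁻¹ * (u : G) = ((rep u₀ : G)⁻¹ * u₀) * ((u₀ : G)⁻¹ * u) := by group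
    rw [h3]
    exact W.toSubgroup.mul_mem (hrep' u₀) hu
  have hWn : (W : Subgroup G).Normal := inferInstance
  -- the cocycle identity of `c̃` on `Uₙ`
  have hcoc : ∀ u u' : U n, c.1 (rep (u * u')) = c.1 (rep u) + (discreteTopRep (U n) M).ρ u (c.1 (rep u')) := by
    intro u u'
    change c.1 (rep (u * u')) = c.1 (rep u) + ((u : G) : G) • c.1 (rep u')
    -- `rep u * rep u'` represents `u u'` (normality of `W`)
    have hprod : c.1 (rep (u * u')) = c.1 (rep u * rep u') := by
      refine hval (u * u') (rep u * rep u') ?_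
      have h3 : ((rep u * rep u' : H) : G)⁻¹ * ((u * u' : U n) : G) =
          ((rep u' : G)⁻¹ * ((rep u : G)⁻¹ * u) * (rep u' : G)) * ((rep u' : G)⁻¹ * u') := by
        simp only [Subgroup.coe_mul, mul_inv_rev]
        group
      rw [h3]
      exact W.toSubgroup.mul_mem (hWn.conj_mem' _ (hrep' u) _) (hrep' u')
    rw [hprod, c.2 (rep u) (rep u')]
    -- `u` acts on `c (rep u')` as `rep u` does (`(rep u)⁻¹ u ∈ W` fixes the values)
    change c.1 (rep u) + ((rep u : H) : G) • c.1 (rep u') = c.1 (rep u) + (u : G) • c.1 (rep u')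
    congr 1
    have h4 : (u : G) = (rep u : G) * ((rep u : G)⁻¹ * u) := by group
    rw [h4, mul_smul, hWfix _ (hrep' u)]
  refine ⟨n, oneCocycleClass (discreteTopRep (U n) M) ⟨⟨fun u => c.1 (rep u), hlc.continuous⟩, hcoc⟩, ?_⟩
  have hres : resOfLe M (hle n)
        (oneCocycleClass (discreteTopRep (U n) M) ⟨⟨fun u => c.1 (rep u), hlc.continuous⟩, hcoc⟩) =
      oneCocycleClass _ (contOneCocycles.pullback (subgroupInclusion (hle n))
        (resHomOfEquivariant (subgroupInclusion (hle n)) (AddMonoidHom.id M) (fun _ _ ↦ rfl))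
          ⟨⟨fun u => c.1 (rep u), hlc.continuous⟩, hcoc⟩) :=
    map_oneCocycleClass _ _ _ _
  rw [hres]
  congr 1
  apply Subtype.ext
  ext h
  change c.1 (rep (Subgroup.inclusion (hle n) h)) = c.1 h
  exact hval _ h (by simp)

end Profinite

/-! ## §3 Injectivity: a layer class dying on `H` dies on a deeper layer -/

/-- **INJECTIVITY half of Serre I §2.2 Prop. 8 in degree `1`**: if `Uₙ` are open, antitone, above `H` and
cofinal among the open neighbourhoods of `H`, a class of `H¹(Uₘ, M)` whose restriction to `H` vanishes
already vanishes on some `Uₙ ≤ Uₘ`. [cite: SerreGaloisCohomology1997, I §2.2 Prop. 8] [cite: NeukirchSchmidtWingberg2008, I §5 (1.5.1)] -/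
theorem exists_resOfLe_eq_zero (hstab : ∀ m : M, IsOpen (MulAction.stabilizer G m : Set G))
    {H : Subgroup G} (U : ℕ → Subgroup G) (hU : ∀ n, IsOpen (U n : Set G))
    (hle : ∀ n, H ≤ U n) (hanti : Antitone U)
    (hcof : ∀ V : Set G, IsOpen V → (H : Set G) ⊆ V → ∃ n, (U n : Set G) ⊆ V)
    {m : ℕ} (y : subgroupH1 (U m) M) (hy : resOfLe M (hle m) y = 0) :
    ∃ n, ∃ hmn : m ≤ n, resOfLe M (hanti hmn) y = 0 := by
  obtain ⟨z, rfl⟩ := oneCocycleClass_surjective _ y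
  obtain ⟨a, ha⟩ := (resOfLe_oneCocycleClass_eq_zero_iff (hle m) z).mp hy
  -- the open set where the corrected cocycle vanishes
  set O : Set G := Subtype.val '' {u : U m | z.1 u = (u : G) • a - a} with hO
  have hOo : IsOpen O := by
    refine (hU m).isOpenMap_subtype_val _ ?_
    have : {u : U m | z.1 u = (u : G) • a - a} = (fun u : U m => z.1 u - ((u : G) • a - a)) ⁻¹' {0} := by
      ext u
      simp only [Set.mem_setOf_eq, Set.mem_preimage, Set.mem_singleton_iff, sub_eq_zero]
    rw [this]
    refine (isOpen_discrete _).preimage (z.1.continuous.sub ?_)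
    exact ((continuous_smul_const_of_isOpen_stabilizer hstab a).comp continuous_subtype_val).sub
      continuous_const
  have hHO : (H : Set G) ⊆ O := fun g hg =>
    ⟨Subgroup.inclusion (hle m) ⟨g, hg⟩, ha ⟨g, hg⟩, rfl⟩
  obtain ⟨n₀, hn₀⟩ := hcof O hOo hHO
  refine ⟨max m n₀, le_max_left m n₀, (resOfLe_oneCocycleClass_eq_zero_iff _ z).mpr ⟨a, fun x => ?_⟩⟩
  obtain ⟨u, hu, hux⟩ := hn₀ (hanti (le_max_right m n₀) x.2)
  have hu' : u = Subgroup.inclusion (hanti (le_max_left m n₀)) x := Subtype.ext hux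
  rw [← hu']
  rw [hu'] at hu ⊢
  exact hu

/-! ## §4 Two layer classes with the same restriction agree on a deeper layer -/

/-- **Equal on `H` ⟹ equal on a deeper layer**: if classes `y ∈ H¹(Uₘ, M)`, `y' ∈ H¹(U_{m'}, M)` have the
same restriction to `H`, their restrictions to some `Uₙ` (`n ≥ m, m'`) coincide.
[cite: SerreGaloisCohomology1997, I §2.2 Prop. 8] -/
theorem exists_resOfLe_eq_resOfLe (hstab : ∀ m : M, IsOpen (MulAction.stabilizer G m : Set G))
    {H : Subgroup G} (U : ℕ → Subgroup G) (hU : ∀ n, IsOpen (U n : Set G))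
    (hle : ∀ n, H ≤ U n) (hanti : Antitone U)
    (hcof : ∀ V : Set G, IsOpen V → (H : Set G) ⊆ V → ∃ n, (U n : Set G) ⊆ V)
    {m m' : ℕ} (y : subgroupH1 (U m) M) (y' : subgroupH1 (U m') M)
    (hyy' : resOfLe M (hle m) y = resOfLe M (hle m') y') :
    ∃ n, ∃ hmn : m ≤ n, ∃ hm'n : m' ≤ n, resOfLe M (hanti hmn) y = resOfLe M (hanti hm'n) y' := by
  -- restrict both to `U_{max m m'}` and apply injectivity to the difference
  set k := max m m' with hk
  have hd : resOfLe M (hle k) (resOfLe M (hanti (le_max_left m m')) y - resOfLe M (hanti (le_max_right m m')) y') = 0 := by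
    rw [map_sub, sub_eq_zero]
    have h1 := congrArg (fun f => f y) (resOfLe_comp_holds (M := M) (hle k) (hanti (le_max_left m m')))
    have h2 := congrArg (fun f => f y') (resOfLe_comp_holds (M := M) (hle k) (hanti (le_max_right m m')))
    simp only [AddMonoidHom.coe_comp, Function.comp_apply] at h1 h2
    rw [h1, h2]
    exact hyy'
  obtain ⟨n, hkn, hn⟩ := exists_resOfLe_eq_zero hstab U hU hle hanti hcof _ hd
  refine ⟨n, (le_max_left m m').trans hkn, (le_max_right m m').trans hkn, ?_⟩
  rw [map_sub, sub_eq_zero] at hn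
  have h1 := congrArg (fun f => f y) (resOfLe_comp_holds (M := M) (hanti hkn) (hanti (le_max_left m m')))
  have h2 := congrArg (fun f => f y') (resOfLe_comp_holds (M := M) (hanti hkn) (hanti (le_max_right m m')))
  simp only [AddMonoidHom.coe_comp, Function.comp_apply] at h1 h2
  rw [h1, h2] at hn
  exact hn

end Literature.NumberTheory.EllipticCurves.SubgroupH1Colimit

end
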